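import Summits.MatrixMultiplication.MatrixMultiplication.Theorems.LevelGradedCohnUmansLevelOneGL2DesignsGaussianUnitalDoor
import Summits.MatrixMultiplication.MatrixMultiplication.Theorems.LevelGradedCohnUmansLevelOneGL2DesignsGaussianUnitalResidueDigits

/-!
# The Gaussian door of the lifted unital fed with base-`9` digits: `p^{5/4}` for every `p ≡ 1 (mod 4)` —
stub `stub_tangencySets` (crux `LevelOneGL2Designs`, stmt-MatrixMultiplication-14080), wall-breaker axis
10/12 "Hermitian unital constructions", generation 1 (seat 3), cycle 2, part 10

Composition of part 9 (`srs_of_normFree_exponent`: norm-difference-free sets of exponent `γ` in `[0,L)`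
give strong representative systems of exponent `1 + γ/2` at every prime `p ≡ 1 (mod 4)`) with part 8
(`normFree_digits_base_nine`: `3^t` integers in `[0,9^t)` no two differing by a sum of two squares, i.e.
`γ = 1/2` with constant `1/3`):

* `srs_gaussianUnital_five_fourths` — every prime `p ≡ 1 (mod 4)` has a strong representative system
  of `AG(2,p)` in the format of `stub_tangencySets` with at least `p^{5/4}/192000` flags.

The exponent `5/4` is not new (the parabola lifts of axes k2/k8 give it, for all primes, by squares
instead of norms); the point is that the unital's door is not vacuous and that its LOCAL ceiling
`γ = 1/2` (parts 6–8: every residue rule has `|D|² ≤ m`) is attained — the record of R8′ is complete: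
door `γ ↦ 1 + γ/2`, local input `= 1/2`, output `5/4`.  Elementary given parts 8–9; no definitions.
-/

-- `Summit.MatrixMultiplication.MatrixMultiplication.…` is the tree's mandated summit/problem namespace (D-0017).
set_option linter.dupNamespace false

namespace Summit.MatrixMultiplication.MatrixMultiplication.Theorems.LevelOneGL2Designs.GaussianUnital

open Finset Matrix

/-- **The unital's own `5/4`.**  Feeding the door with the base-`9` digit sets of part 8
(`normFree_digits_base_nine`: `3^t` integers in `[0,9^t)`, so `≥ √L/3` in `[0,L)`): every prime
`p ≡ 1 (mod 4)` has a strong representative system in the stub's format with at least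
`p^{5/4}/192000` flags.  (Known exponent — the parabola lifts of axes k2/k8 give `5/4` too, for all
primes; recorded to show the door is not vacuous and that its local ceiling `γ = 1/2` is attained.)
[this file + part 8] -/
theorem srs_gaussianUnital_five_fourths {p : ℕ} [Fact p.Prime] (hp : p % 4 = 1) :
    ∃ S : Finset ((Fin 2 → ZMod p) × (Fin 2 → ZMod p)),
      (1 : ℝ) / 192000 * (p : ℝ) ^ ((5 : ℝ) / 4) ≤ S.card ∧
      ∀ f ∈ S, ∀ f' ∈ S, (dotProduct f.1 f'.2 = 1 ↔ f = f') := by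
  have hin : ∀ L : ℕ, ∃ U : Finset ℤ, 1 / 3 * (L : ℝ) ^ ((1 : ℝ) / 2) ≤ U.card ∧
      (∀ a ∈ U, 0 ≤ a ∧ a < L) ∧
      ∀ a ∈ U, ∀ a' ∈ U, a ≠ a' → ¬ ∃ x y : ℕ, (a - a').natAbs = x ^ 2 + y ^ 2 := by
    intro L
    rcases Nat.eq_zero_or_pos L with hL0 | hLpos
    · refine ⟨∅, ?_, by simp, by simp⟩
      subst hL0
      simp
    · set t : ℕ := Nat.log 9 L with ht
      have h9le : 9 ^ t ≤ L := Nat.pow_log_le_self 9 hLpos.ne'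
      have h9lt : L < 9 ^ (t + 1) := Nat.lt_pow_succ_log_self (by norm_num) L
      obtain ⟨A, hcard, hbox, hfree⟩ := normFree_digits_base_nine t
      refine ⟨A, ?_, fun a ha => ⟨(hbox a ha).1, (hbox a ha).2.trans_le (by exact_mod_cast h9le)⟩,
        hfree⟩
      rw [hcard]
      -- `√L / 3 ≤ 3^t` since `L < 9^{t+1} = (3·3^t)²`
      have hsq : (L : ℝ) ≤ ((3 : ℝ) * 3 ^ t) ^ 2 := by
        have : L ≤ (3 * 3 ^ t) ^ 2 := by
          have e : (3 * 3 ^ t) ^ 2 = 9 ^ (t + 1) := by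
            rw [show (9 : ℕ) = 3 ^ 2 by norm_num, ← pow_mul]
            ring
          rw [e]; exact h9lt.le
        exact_mod_cast this
      have hroot : Real.sqrt L ≤ 3 * 3 ^ t := by
        calc Real.sqrt L ≤ Real.sqrt (((3 : ℝ) * 3 ^ t) ^ 2) := Real.sqrt_le_sqrt hsq
          _ = 3 * 3 ^ t := Real.sqrt_sq (by positivity)
      rw [← Real.sqrt_eq_rpow]
      push_cast
      linarith
  obtain ⟨S, hS, hsrs⟩ := srs_of_normFree_exponent (γ := 1 / 2) (c := 1 / 3) (by norm_num)
    (by norm_num) (by norm_num) hin hp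
  refine ⟨S, ?_, hsrs⟩
  have e1 : (1 : ℝ) + 1 / 2 / 2 = 5 / 4 := by norm_num
  have e2 : (1 : ℝ) / 3 / 64000 = 1 / 192000 := by norm_num
  rw [e1, e2] at hS
  exact hS

end Summit.MatrixMultiplication.MatrixMultiplication.Theorems.LevelOneGL2Designs.GaussianUnital
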